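import Literature.NumberTheory.EllipticCurves.SingularModuliGaloisStable
import Literature.NumberTheory.EllipticCurves.ComplexMultiplicationHasCMTwoLeavesProofs
import HarnessLib

/-!
# The class equation `H_D(X) ∈ ℚ[X]` is irreducible of degree `h(D)`:
# discharge of `irreducible_classPolynomial` (Cox, *Primes of the form x² + ny²*, Prop. 13.2)

Topic `NumberTheory/EllipticCurves` (complex multiplication); a proofs-only sibling (theorems only,
no definitions, no named facts) of `ComplexMultiplicationJInvariantProofs.lean`, whose named fact

* `Literature.NumberTheory.EllipticCurves.irreducible_classPolynomial` — for every discriminant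
  `D < 0`, `D ≡ 0, 1 (mod 4)`, the class polynomial `H_D = ∏_{Q reduced of disc D} (X − j(τ_Q))`
  (`classPolynomial D`) is the image in `ℂ[X]` of an irreducible polynomial of `ℚ[X]` (Cox,
  *Primes of the form x² + ny²*, 2nd ed., §13.A Prop. 13.2 with Thm. 11.1: `H_𝒪(X) = ∏ (X − j(𝔞ᵢ))`
  is the minimal polynomial of `j(𝒪)`, of degree `h(𝒪)`)

is **proved** here (`irreducible_classPolynomial_holds`), as `H_D = minpoly_ℚ(j(τ_P))` for the
principal form `P` (`minpoly_formJ_map_eq_classPolynomial`).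

## The proof and its provenance

Cox proves Prop. 13.2 from Thm. 11.1 ("`K(j(𝔞))` is the ring class field", via class field theory)
and (10.26).  The tree now holds a proof **without class field theory**, along Deuring's algebraic
route (Cox §11.D, "We will follow the proof given by Deuring"), in three independent pieces:

1. **All singular moduli of discriminant `D` are conjugate** — `singularModuli_conjugate_holds`
   (`SingularModuliConjugate.lean`): the modular equation `Φ_ℓ ∈ ℤ[X, Y]`, Kronecker's congruence and
   a Frobenius element link `j(τ_Q)` to `j(τ_P)` along a chain of prime-index sublattices
   (Cox (11.30)–(11.33)); so every `j(τ_Q)`, `Q` reduced of discriminant `D`, is a root of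
   `H = minpoly_ℚ(j(τ_P))`.
2. **`j` separates reduced forms** — `formJ_injOn_reducedForms`
   (`ComplexMultiplicationHasCMTwoLeavesProofs.lean`; Cox Thm. 11.2 with Thm. 2.8): the `h(D)` roots
   `j(τ_Q)` of `H_D` are distinct, so `H_D ∣ H` in `ℂ[X]`.
3. **Cox Thm. 10.23** — `natDegree_minpoly_formJ_le_classNumber`, `isIntegral_formJ`
   (`SingularModuliGaloisStable.lean`, with `CMTransformationPolynomials.lean` and
   `FieldTheory/AlgClosed/AutomorphismExtension.lean`): `j(τ_P)` is algebraic of degree `≤ h(D)`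
   (its `Aut(ℂ)`-conjugates are singular moduli of discriminant `D`, (10.26)).

Since `H_D` and `H` are monic, `H_D ∣ H` and `deg H ≤ h(D) = deg H_D` give `H = H_D`; `H` is
irreducible as a minimal polynomial.  Consequently the named fact and all its uses
(`classNumber_eq_one_of_formJ_eq`, the field of singular moduli in
`HeegnerPointsSingularModuliField.lean`, …) are now unconditional on this point.

## References

* D. A. Cox, *Primes of the form x² + ny²*, 2nd ed., Wiley 2013, §13.A Prop. 13.2 and the following
  paragraph (PDF pp. 288–289 of the held copy); §10.C Thm. 10.23; §11.A Thm. 11.2; §11.D proof of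
  Thm. 11.1; §2.A Thm. 2.8. [Cox2013]
* M. Deuring, *Die Klassenkörper der komplexen Multiplikation*, Enzykl. Math. Wiss. I.2, Heft 10,
  Teil II (1958), §10.
-/

noncomputable section

open Polynomial

namespace Literature.NumberTheory.EllipticCurves

open Literature.NumberTheory.QuadraticFields.BinaryQuadraticForm

/-- **`H_D = minpoly_ℚ(j(τ_Q))` for every reduced form `Q` of discriminant `D < 0`**: the class
polynomial is the image in `ℂ[X]` of the minimal polynomial over `ℚ` of each of its roots (Cox,
§13.A: "`H_𝒪(X)` is the minimal polynomial of `j(𝔞)`, where `𝔞` is any proper fractional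
`𝒪`-ideal").  `H_D ∣ minpoly` by conjugacy (`singularModuli_conjugate_holds`) and distinctness of
the `j(τ_R)` (`formJ_injOn_reducedForms`); equality by the degree bound of Thm. 10.23
(`natDegree_minpoly_formJ_le_classNumber`) and monicity.
[cite: Cox2013, §13.A Prop. 13.2 and the following paragraph] -/
theorem minpoly_formJ_map_eq_classPolynomial {D : ℤ} (hD : D < 0) {Q : ℤ × ℤ × ℤ}
    (hQ : Q ∈ reducedForms D) :
    (minpoly ℚ (formJ Q)).map (algebraMap ℚ ℂ) = classPolynomial D := by
  classical
  obtain ⟨hdQ, hQ1, hQprim, -⟩ := (mem_reducedForms_iff hD).1 hQ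
  have hdisc : discr Q < 0 := by rw [hdQ]; exact hD
  set H := minpoly ℚ (formJ Q) with hH
  have hint : IsIntegral ℚ (formJ Q) := isIntegral_formJ hQ1 hQprim hdisc
  have hHmonic : (H.map (algebraMap ℚ ℂ)).Monic := (minpoly.monic hint).map _
  have hH0 : H.map (algebraMap ℚ ℂ) ≠ 0 := hHmonic.ne_zero
  have hcls : (classPolynomial D).Monic := by
    rw [classPolynomial]
    exact monic_prod_of_monic _ _ fun R _ => monic_X_sub_C _
  -- `H_D ∣ H`: every `j(τ_R)`, `R` reduced, is a root of `H`, and they are distinct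
  have hdvd : classPolynomial D ∣ H.map (algebraMap ℚ ℂ) := by
    have hprod : classPolynomial D = (((reducedForms D).val.map formJ).map fun y => X - C y).prod := by
      rw [classPolynomial, Finset.prod_eq_multiset_prod, Multiset.map_map]
      rfl
    rw [hprod, Multiset.prod_X_sub_C_dvd_iff_le_roots hH0]
    have hnodup : ((reducedForms D).val.map formJ).Nodup :=
      Multiset.Nodup.map_on (fun R hR R' hR' h =>
        formJ_injOn_reducedForms hD (Finset.mem_coe.2 (Finset.mem_def.2 hR))
          (Finset.mem_coe.2 (Finset.mem_def.2 hR')) h)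
        (reducedForms D).nodup
    rw [Multiset.le_iff_subset hnodup]
    intro y hy
    obtain ⟨R, hR, rfl⟩ := Multiset.mem_map.1 hy
    obtain ⟨hdR, hR1, hRprim, -⟩ := (mem_reducedForms_iff hD).1 (Finset.mem_def.2 hR)
    rw [mem_roots hH0, IsRoot.def, eval_map, ← aeval_def]
    exact singularModuli_conjugate_holds Q R hQ1 hQprim hR1 hRprim hdisc (hdR.trans hdQ.symm) H
      (minpoly.aeval ℚ _)
  -- degrees: `deg H ≤ h(D) = deg H_D`
  have hdeg : (H.map (algebraMap ℚ ℂ)).natDegree ≤ (classPolynomial D).natDegree := by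
    rw [natDegree_map, natDegree_classPolynomial]
    have h := natDegree_minpoly_formJ_le_classNumber hQ1 hQprim hdisc
    rwa [hdQ] at h
  exact eq_of_monic_of_dvd_of_natDegree_le hcls hHmonic hdvd hdeg

/-- **The class equation is irreducible over `ℚ`** — discharge of the named fact
`irreducible_classPolynomial` (Cox, *Primes of the form x² + ny²*, §13.A Prop. 13.2 with Thm. 11.1:
`H_𝒪(X) = ∏ᵢ (X − j(𝔞ᵢ))` is the (monic, irreducible) minimal polynomial of `j(𝒪)` over `ℚ`, of
degree `h(𝒪)`): for `D < 0`, `D ≡ 0, 1 (mod 4)`, `classPolynomial D` is the image of the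
irreducible polynomial `minpoly_ℚ(j(τ_P)) ∈ ℚ[X]`, `P` the principal form of discriminant `D`.
Proved without class field theory (see the module docstring).
[cite: Cox2013, §13.A Prop. 13.2 (with Thm. 11.1, Thm. 7.7(ii), Thm. 2.8)] -/
theorem irreducible_classPolynomial_holds : irreducible_classPolynomial := by
  intro D hD h4
  have hP : principalForm D ∈ reducedForms D := principalForm_mem_reducedForms hD h4
  obtain ⟨hdP, hP1, hPprim, -⟩ := (mem_reducedForms_iff hD).1 hP
  have hdisc : discr (principalForm D) < 0 := by rw [hdP]; exact hD
  exact ⟨minpoly ℚ (formJ (principalForm D)),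
    minpoly.irreducible (isIntegral_formJ hP1 hPprim hdisc),
    minpoly_formJ_map_eq_classPolynomial hD hP⟩

end Literature.NumberTheory.EllipticCurves

end
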